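import Summits.QuantumFields.YangMills.Theorems.SwapVirialDeficitZeroModeSigmaFourSmallBallRatePieces
import Summits.QuantumFields.YangMills.Theorems.SwapVirialDeficitZeroModeSigmaFourSmallBallRateDecomp
import HarnessLib

/-!
# Exact zero-mode rung Z5 — toward the POWER RATE of the σ-twisted four-leader small ball, measure side VI: the per-hub bound
# (free-hands support of ⟨stmt-QuantumFields-24197⟩; split with w3 g63: deterministic Taylor package ✓`…SmallBallTaylor`, measure side w2 g56)

At a hub `A = radialUnit (axisPoint a)` with `a₀ ≠ 0`, `Im a ≠ 0`, the symmetric difference of the rescaled event `rescaledSigmaR r s A` and the limit event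
`limSigma r A` is, by ✓`flip_subset` (part IV), inside NULL ∪ (eight coordinate cuts ∩ (event ∪ limit)) ∪ SHELL; the event is dominated by
✓`sigmaDom` (✓`indicator_rescaledSigma_axis_le_sigmaDom`), the limit event a.e. (hypothesis `hLdom`, discharged at a good threshold in part VII from the
pointwise limit), so each cut costs twice its dominator mass (part V) and the shell costs `14δ(r+δ)⁶·vol³(limSigma 1 A)` (part I):
* §N `ae_vol3_re_ne_zero`, `measure_inter_le_lintegral` (`vol³(S ∩ E) ≤ ∫𝟙_S·D` when `𝟙_E ≤ D` a.e.), `measure_union_inter_le`;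
* §O ★★★ `volume_flipSet_le` — the PER-HUB BOUND with free parameters `ε, R₀, p` (all pieces explicit).
HONEST LABEL: finite-dimensional real analysis (plan-level zero-mode rung of a DRAFT line «sharp-sigma»); NOT the fixed-`L` sharp law, NOT ⟨24197⟩; the
Yang–Mills mass gap is NOT proved; no summit is proved by a line.  Width seat ym-line-sfw-p2-w2 g56 (cell ym-idea-1, free hands; own crux ⟨22884⟩ blocked-on ⟨19935⟩),
`--supports stmt-QuantumFields-24197`.  THEOREMS ONLY, standard axioms, 0 `sorry`.  References: [cite: Luscher1983, §2]; [cite: Vanbaal2001]; [folklore].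
-/

set_option autoImplicit false

noncomputable section

open MeasureTheory Quaternion Set Filter Topology
open scoped Quaternion ENNReal BigOperators
open Literature.MathematicalPhysics.QuantumLattice
open Literature.Analysis.Calculus (radialUnit radialUnit_def norm_radialUnit)
open Summit.QuantumFields.YangMills.Theorems.SwapTwistDeficit.ToronLog
open Summit.QuantumFields.YangMills.Theorems.SwapVirialDeficit.ZeroModeGroup

attribute [local instance] Literature.Analysis.FluidPDE.Tao2016.quatMeasurableSpace
  Literature.Analysis.FluidPDE.Tao2016.quatBorelSpace

namespace Summit.QuantumFields.YangMills.Theorems.SwapVirialDeficit.ZeroModeSigma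

/-! ## §N Null sets, domination, union bookkeeping -/

/-- `vol³`-almost every `((x,y),z)` has `x₀ ≠ 0`, `y₀ ≠ 0`, `z₀ ≠ 0`. [folklore] -/
theorem ae_vol3_re_ne_zero : ∀ᵐ w : (ℍ × ℍ) × ℍ ∂vol3, w.1.1.re ≠ 0 ∧ w.1.2.re ≠ 0 ∧ w.2.re ≠ 0 := by
  have h0 : ∀ᵐ x : ℍ ∂(volume : Measure ℍ), x.re ≠ 0 := by
    rw [ae_iff]; simpa only [ne_eq, not_not] using Literature.MathematicalPhysics.QuantumLattice.volume_re_eq_zero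
  haveI := sFinite_vol3
  rw [vol3_def]
  have hx : ∀ᵐ w : (ℍ × ℍ) × ℍ ∂(((volume : Measure ℍ).prod volume).prod volume), w.1.1.re ≠ 0 :=
    ((Measure.quasiMeasurePreserving_fst (μ := (volume : Measure ℍ)) (ν := (volume : Measure ℍ))).comp
      (Measure.quasiMeasurePreserving_fst (μ := (volume : Measure ℍ).prod volume) (ν := (volume : Measure ℍ)))).ae h0
  have hy : ∀ᵐ w : (ℍ × ℍ) × ℍ ∂(((volume : Measure ℍ).prod volume).prod volume), w.1.2.re ≠ 0 :=
    ((Measure.quasiMeasurePreserving_snd (μ := (volume : Measure ℍ)) (ν := (volume : Measure ℍ))).comp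
      (Measure.quasiMeasurePreserving_fst (μ := (volume : Measure ℍ).prod volume) (ν := (volume : Measure ℍ)))).ae h0
  have hz : ∀ᵐ w : (ℍ × ℍ) × ℍ ∂(((volume : Measure ℍ).prod volume).prod volume), w.2.re ≠ 0 :=
    (Measure.quasiMeasurePreserving_snd (μ := (volume : Measure ℍ).prod volume) (ν := (volume : Measure ℍ))).ae h0
  filter_upwards [hx, hy, hz] with w a b c using ⟨a, b, c⟩

/-- The NULL set of ✓`flip_subset` is `vol³`-null. [folklore] -/
theorem volume_nullSet_eq_zero : vol3 {w : (ℍ × ℍ) × ℍ | axPart w.1.1 = 0 ∨ axPart w.1.2 = 0 ∨ w.2.re = 0} = 0 := by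
  refine measure_eq_zero_iff_ae_notMem.2 ?_
  filter_upwards [ae_vol3_re_ne_zero] with w hw
  have hre : ∀ x : ℍ, axPart x = 0 → x.re = 0 := fun x h => by
    have := congrArg (fun q : ℍ => q.re) h; simpa [axPart] using this
  rintro (h | h | h)
  · exact hw.1 (hre _ h)
  · exact hw.2.1 (hre _ h)
  · exact hw.2.2 h

/-- `vol³(S ∩ E) ≤ ∫ 𝟙_S·D` when `𝟙_E ≤ D` almost everywhere (`S`, `E` measurable). [folklore] -/
theorem measure_inter_le_lintegral {S E : Set ((ℍ × ℍ) × ℍ)} (hS : MeasurableSet S) (hE : MeasurableSet E) {D : (ℍ × ℍ) × ℍ → ℝ≥0∞}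
    (hdom : ∀ᵐ w ∂vol3, E.indicator (1 : (ℍ × ℍ) × ℍ → ℝ≥0∞) w ≤ D w) :
    vol3 (S ∩ E) ≤ ∫⁻ w, S.indicator (fun _ => (1 : ℝ≥0∞)) w * D w ∂vol3 := by
  rw [← lintegral_indicator_one (hS.inter hE)]
  refine lintegral_mono_ae (hdom.mono fun w hw => ?_)
  by_cases h1 : w ∈ S
  · by_cases h2 : w ∈ E
    · rw [indicator_of_mem (Set.mem_inter h1 h2), indicator_of_mem h1, one_mul, Pi.one_apply]
      rw [indicator_of_mem h2, Pi.one_apply] at hw; exact hw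
    · rw [indicator_of_notMem (fun h => h2 (Set.mem_of_mem_inter_right h))]; exact bot_le
  · rw [indicator_of_notMem (fun h => h1 (Set.mem_of_mem_inter_left h))]; exact bot_le

/-- `vol³((S ∪ T) ∩ E) ≤ vol³(S ∩ E) + vol³(T ∩ E)`. [folklore] -/
theorem measure_union_inter_le (S T E : Set ((ℍ × ℍ) × ℍ)) : vol3 ((S ∪ T) ∩ E) ≤ vol3 (S ∩ E) + vol3 (T ∩ E) := by
  rw [Set.union_inter_distrib_right]; exact measure_union_le _ _

/-- The rescaled event at threshold `r ≤ 1` is dominated: `𝟙_{rescaledSigmaR r s A(a)} ≤ sigmaDom A(a)` a.e. (`0 < s`, `a ≠ 0`). [folklore] -/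
theorem ae_indicator_rescaledSigmaR_le {r s : ℝ} (hr : r ≤ 1) (hs : 0 < s) {a : ℍ} (ha : a ≠ 0) :
    ∀ᵐ w ∂vol3, (rescaledSigmaR r s (radialUnit (axisPoint a))).indicator (1 : (ℍ × ℍ) × ℍ → ℝ≥0∞) w ≤ sigmaDom (radialUnit (axisPoint a)) w := by
  filter_upwards [ae_vol3_re_ne_zero] with w hw
  have hx : w.1.1 ≠ 0 := fun h => hw.1 (by rw [h]; rfl)
  refine le_trans ?_ (indicator_rescaledSigma_axis_le_sigmaDom hs ha w hx)
  exact Set.indicator_le_indicator_of_subset (rescaledSigmaR_subset hr hs.le _) (fun _ => bot_le) w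

/-! ## §O The per-hub bound -/

/-- ★★★ **THE PER-HUB BOUND.**  At a hub `A = radialUnit (axisPoint a)` (`a₀ ≠ 0`, `Im a ≠ 0`), for `0 < s`, `r ≤ 1`, `rs < 1`, `0 < R₀`, `sR₀ ≤ 1/4`,
`0 < ε`, `0 < p ≤ 1/2`, `δ = 8sR₀² < r`, and the limit event dominated a.e. (`hLdom`): the symmetric difference of `rescaledSigmaR r s A` and
`limSigma r A` has `vol³` at most twice the eight dominator pieces of part V (parameters `ε`, `T = (R₀/3)²ε²`, `c = (R₀/3)²`, `s`) plus the shell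
`14δ(r+δ)⁶·vol³(limSigma 1 A)`. [folklore] -/
theorem volume_flipSet_le {a : ℍ} (hre : a.re ≠ 0) (him : a.im ≠ 0) {r s R₀ ε p : ℝ} (hs : 0 < s) (hr1 : r ≤ 1)
    (hrs : r * s < 1) (hR0 : 0 < R₀) (hR : s * R₀ ≤ 1 / 4) (hε : 0 < ε) (hp : 0 < p) (hp2 : p ≤ 1 / 2) (hδ : 8 * s * R₀ ^ 2 < r)
    (hLdom : ∀ᵐ w ∂vol3, (limSigma r (radialUnit (axisPoint a))).indicator (1 : (ℍ × ℍ) × ℍ → ℝ≥0∞) w ≤ sigmaDom (radialUnit (axisPoint a)) w) :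
    vol3 ((rescaledSigmaR r s (radialUnit (axisPoint a)) \ limSigma r (radialUnit (axisPoint a))) ∪
        (limSigma r (radialUnit (axisPoint a)) \ rescaledSigmaR r s (radialUnit (axisPoint a)))) ≤
      2 * (2 * (ENNReal.ofReal (4 * ε) * blockB (radialUnit (axisPoint a)).re (radialUnit (axisPoint a)).imI * (16 * ENNReal.ofReal (Real.exp 4))) +
        2 * (ENNReal.ofReal (4 * ((R₀ / 3) ^ 2 * ε ^ 2) ^ (-p)) *
          (2 * (ENNReal.ofReal ((4 / ((radialUnit (axisPoint a)).re ^ 2 * (radialUnit (axisPoint a)).imI ^ 4)) ^ p * 2) *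
            blockB (radialUnit (axisPoint a)).re (radialUnit (axisPoint a)).imI)) * (16 * ENNReal.ofReal (Real.exp 4))) +
        2 * (ENNReal.ofReal (4 * (s ^ 2) ^ p) *
          (2 * (ENNReal.ofReal ((4 / ((radialUnit (axisPoint a)).re ^ 2 * (radialUnit (axisPoint a)).imI ^ 4)) ^ p * 2) *
            blockB (radialUnit (axisPoint a)).re (radialUnit (axisPoint a)).imI)) * (16 * ENNReal.ofReal (Real.exp 4))) +
        4 * blockB (radialUnit (axisPoint a)).re (radialUnit (axisPoint a)).imI *
          (ENNReal.ofReal (2 * Real.sqrt (3 / (R₀ / 3) ^ 2)) * 8 * ENNReal.ofReal (Real.exp 4)) +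
        4 * blockB (radialUnit (axisPoint a)).re (radialUnit (axisPoint a)).imI *
          (ENNReal.ofReal (2 * (3 * s ^ 2) ^ (1 / 2 : ℝ)) * 8 * ENNReal.ofReal (Real.exp 4))) +
      ENNReal.ofReal (14 * (8 * s * R₀ ^ 2) * (r + 8 * s * R₀ ^ 2) ^ 6) * vol3 (limSigma 1 (radialUnit (axisPoint a))) := by
  set A := radialUnit (axisPoint a) with hAdef
  have ha : a ≠ 0 := fun h => hre (by rw [h]; rfl)
  have hA : ‖A‖ = 1 := norm_axisUnit ha
  have hJ : A.imJ = 0 := (axisUnit_axial a).1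
  have hK : A.imK = 0 := (axisUnit_axial a).2
  have h1 : A.re ^ 2 + A.imI ^ 2 = 1 := axial_sq_add_sq hA hJ hK
  obtain ⟨eR, eM⟩ := axisUnit_sq a
  have hN : 0 < ‖a‖ ^ 2 := by positivity
  have hα : A.re ≠ 0 := by
    intro h; rw [hAdef] at h; rw [h] at eR
    have : 0 < a.re ^ 2 / ‖a‖ ^ 2 := div_pos (by positivity) hN
    rw [← eR] at this; simp at this
  have hβ : A.imI ≠ 0 := by
    intro h; rw [hAdef] at h; rw [h] at eM
    have : 0 < ‖a.im‖ ^ 2 / ‖a‖ ^ 2 := div_pos (by have := norm_pos_iff.2 him; positivity) hN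
    rw [← eM] at this; simp at this
  -- names for the sets
  set R := rescaledSigmaR r s A with hRdef
  set L := limSigma r A with hLdef
  set P₁ := {w : (ℍ × ℍ) × ℍ | w.1.1.re ^ 2 + w.1.1.imI ^ 2 < ε ^ 2} with hP₁
  set P₂ := {w : (ℍ × ℍ) × ℍ | (R₀ / 3) ^ 2 * ε ^ 2 < w.1.1.imJ ^ 2 + w.1.1.imK ^ 2} with hP₂
  set P₃ := {w : (ℍ × ℍ) × ℍ | w.1.2.re ^ 2 + w.1.2.imI ^ 2 < ε ^ 2} with hP₃
  set P₄ := {w : (ℍ × ℍ) × ℍ | (R₀ / 3) ^ 2 * ε ^ 2 < w.1.2.imJ ^ 2 + w.1.2.imK ^ 2} with hP₄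
  set P₅ := {w : (ℍ × ℍ) × ℍ | (R₀ / 3) ^ 2 * w.2.re ^ 2 < w.2.imI ^ 2 + w.2.imJ ^ 2 + w.2.imK ^ 2} with hP₅
  set P₆ := {w : (ℍ × ℍ) × ℍ | 1 - s ^ 2 * (w.1.1.imJ ^ 2 + w.1.1.imK ^ 2) ≤ w.1.1.re ^ 2 + w.1.1.imI ^ 2 ∧ w.1.1.re ^ 2 + w.1.1.imI ^ 2 < 1} with hP₆
  set P₇ := {w : (ℍ × ℍ) × ℍ | 1 - s ^ 2 * (w.1.2.imJ ^ 2 + w.1.2.imK ^ 2) ≤ w.1.2.re ^ 2 + w.1.2.imI ^ 2 ∧ w.1.2.re ^ 2 + w.1.2.imI ^ 2 < 1} with hP₇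
  set P₈ := {w : (ℍ × ℍ) × ℍ | 1 - s ^ 2 * (w.2.imI ^ 2 + w.2.imJ ^ 2 + w.2.imK ^ 2) ≤ w.2.re ^ 2 ∧ w.2.re ^ 2 < 1} with hP₈
  set N := {w : (ℍ × ℍ) × ℍ | axPart w.1.1 = 0 ∨ axPart w.1.2 = 0 ∨ w.2.re = 0} with hNdef
  set SH := limSigma (r + 8 * s * R₀ ^ 2) A \ limSigma (r - 8 * s * R₀ ^ 2) A with hSH
  have hsub : (R \ L) ∪ (L \ R) ⊆ N ∪ ((P₁ ∪ P₂ ∪ P₃ ∪ P₄ ∪ P₅ ∪ P₆ ∪ P₇ ∪ P₈) ∩ (R ∪ L)) ∪ SH :=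
    flip_subset (ε := ε) hA hJ hK hs hrs hR0.le hR
  -- measurability
  have mR : MeasurableSet R := measurableSet_rescaledSigmaR r s A
  have mL : MeasurableSet L := measurableSet_limSigma_axis r a
  have m₁ : MeasurableSet P₁ := measurableSet_lt (by fun_prop) measurable_const
  have m₂ : MeasurableSet P₂ := measurableSet_lt measurable_const (by fun_prop)
  have m₃ : MeasurableSet P₃ := measurableSet_lt (by fun_prop) measurable_const
  have m₄ : MeasurableSet P₄ := measurableSet_lt measurable_const (by fun_prop)
  have m₅ : MeasurableSet P₅ := measurableSet_lt (by fun_prop) (by fun_prop)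
  have m₆ : MeasurableSet P₆ := by
    rw [hP₆, Set.setOf_and]; exact (measurableSet_le (by fun_prop) (by fun_prop)).inter (measurableSet_lt (by fun_prop) measurable_const)
  have m₇ : MeasurableSet P₇ := by
    rw [hP₇, Set.setOf_and]; exact (measurableSet_le (by fun_prop) (by fun_prop)).inter (measurableSet_lt (by fun_prop) measurable_const)
  have m₈ : MeasurableSet P₈ := by
    rw [hP₈, Set.setOf_and]; exact (measurableSet_le (by fun_prop) (by fun_prop)).inter (measurableSet_lt (by fun_prop) measurable_const)
  -- the dominated pieces, for a dominated measurable event `E`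
  have hRdom : ∀ᵐ w ∂vol3, R.indicator (1 : (ℍ × ℍ) × ℍ → ℝ≥0∞) w ≤ sigmaDom A w := ae_indicator_rescaledSigmaR_le hr1 hs ha
  have hT : 0 < (R₀ / 3) ^ 2 * ε ^ 2 := by positivity
  have hc : 0 < (R₀ / 3) ^ 2 := by positivity
  have hp1 : p ≤ 1 := hp2.trans (by norm_num)
  have pieces : ∀ {E : Set ((ℍ × ℍ) × ℍ)}, MeasurableSet E → (∀ᵐ w ∂vol3, E.indicator (1 : (ℍ × ℍ) × ℍ → ℝ≥0∞) w ≤ sigmaDom A w) →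
      vol3 ((P₁ ∪ P₂ ∪ P₃ ∪ P₄ ∪ P₅ ∪ P₆ ∪ P₇ ∪ P₈) ∩ E) ≤
        ENNReal.ofReal (4 * ε) * blockB A.re A.imI * (16 * ENNReal.ofReal (Real.exp 4)) +
        ENNReal.ofReal (4 * ((R₀ / 3) ^ 2 * ε ^ 2) ^ (-p)) * (2 * (ENNReal.ofReal ((4 / (A.re ^ 2 * A.imI ^ 4)) ^ p * 2) * blockB A.re A.imI)) *
          (16 * ENNReal.ofReal (Real.exp 4)) +
        ENNReal.ofReal (4 * ε) * blockB A.re A.imI * (16 * ENNReal.ofReal (Real.exp 4)) +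
        ENNReal.ofReal (4 * ((R₀ / 3) ^ 2 * ε ^ 2) ^ (-p)) * (2 * (ENNReal.ofReal ((4 / (A.re ^ 2 * A.imI ^ 4)) ^ p * 2) * blockB A.re A.imI)) *
          (16 * ENNReal.ofReal (Real.exp 4)) +
        4 * blockB A.re A.imI * (ENNReal.ofReal (2 * Real.sqrt (3 / (R₀ / 3) ^ 2)) * 8 * ENNReal.ofReal (Real.exp 4)) +
        ENNReal.ofReal (4 * (s ^ 2) ^ p) * (2 * (ENNReal.ofReal ((4 / (A.re ^ 2 * A.imI ^ 4)) ^ p * 2) * blockB A.re A.imI)) *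
          (16 * ENNReal.ofReal (Real.exp 4)) +
        ENNReal.ofReal (4 * (s ^ 2) ^ p) * (2 * (ENNReal.ofReal ((4 / (A.re ^ 2 * A.imI ^ 4)) ^ p * 2) * blockB A.re A.imI)) *
          (16 * ENNReal.ofReal (Real.exp 4)) +
        4 * blockB A.re A.imI * (ENNReal.ofReal (2 * (3 * s ^ 2) ^ (1 / 2 : ℝ)) * 8 * ENNReal.ofReal (Real.exp 4)) := by
    intro E mE hE
    have b₁ := (measure_inter_le_lintegral m₁ mE hE).trans (lintegral_pieceXS_le h1 hα hβ hε.le)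
    have b₂ := (measure_inter_le_lintegral m₂ mE hE).trans (lintegral_pieceXL_le h1 hα hβ hT hp hp1)
    have b₃ := (measure_inter_le_lintegral m₃ mE hE).trans (lintegral_pieceYS_le h1 hα hβ hε.le)
    have b₄ := (measure_inter_le_lintegral m₄ mE hE).trans (lintegral_pieceYL_le h1 hα hβ hT hp hp1)
    have b₅ := (measure_inter_le_lintegral m₅ mE hE).trans (lintegral_pieceZC_le h1 hα hβ hc)
    have b₆ := (measure_inter_le_lintegral m₆ mE hE).trans (lintegral_pieceXLayer_le h1 hα hβ s hp hp2)
    have b₇ := (measure_inter_le_lintegral m₇ mE hE).trans (lintegral_pieceYLayer_le h1 hα hβ s hp hp2)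
    have b₈ := (measure_inter_le_lintegral m₈ mE hE).trans (lintegral_pieceZLayer_le h1 hα hβ s)
    calc vol3 ((P₁ ∪ P₂ ∪ P₃ ∪ P₄ ∪ P₅ ∪ P₆ ∪ P₇ ∪ P₈) ∩ E)
        ≤ vol3 ((P₁ ∪ P₂ ∪ P₃ ∪ P₄ ∪ P₅ ∪ P₆ ∪ P₇) ∩ E) + vol3 (P₈ ∩ E) := measure_union_inter_le _ _ _
      _ ≤ vol3 ((P₁ ∪ P₂ ∪ P₃ ∪ P₄ ∪ P₅ ∪ P₆) ∩ E) + vol3 (P₇ ∩ E) + vol3 (P₈ ∩ E) := by gcongr; exact measure_union_inter_le _ _ _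
      _ ≤ vol3 ((P₁ ∪ P₂ ∪ P₃ ∪ P₄ ∪ P₅) ∩ E) + vol3 (P₆ ∩ E) + vol3 (P₇ ∩ E) + vol3 (P₈ ∩ E) := by gcongr; exact measure_union_inter_le _ _ _
      _ ≤ vol3 ((P₁ ∪ P₂ ∪ P₃ ∪ P₄) ∩ E) + vol3 (P₅ ∩ E) + vol3 (P₆ ∩ E) + vol3 (P₇ ∩ E) + vol3 (P₈ ∩ E) := by
          gcongr; exact measure_union_inter_le _ _ _
      _ ≤ vol3 ((P₁ ∪ P₂ ∪ P₃) ∩ E) + vol3 (P₄ ∩ E) + vol3 (P₅ ∩ E) + vol3 (P₆ ∩ E) + vol3 (P₇ ∩ E) + vol3 (P₈ ∩ E) := by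
          gcongr; exact measure_union_inter_le _ _ _
      _ ≤ vol3 ((P₁ ∪ P₂) ∩ E) + vol3 (P₃ ∩ E) + vol3 (P₄ ∩ E) + vol3 (P₅ ∩ E) + vol3 (P₆ ∩ E) + vol3 (P₇ ∩ E) + vol3 (P₈ ∩ E) := by
          gcongr; exact measure_union_inter_le _ _ _
      _ ≤ vol3 (P₁ ∩ E) + vol3 (P₂ ∩ E) + vol3 (P₃ ∩ E) + vol3 (P₄ ∩ E) + vol3 (P₅ ∩ E) + vol3 (P₆ ∩ E) + vol3 (P₇ ∩ E) + vol3 (P₈ ∩ E) := by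
          gcongr; exact measure_union_inter_le _ _ _
      _ ≤ _ := by gcongr
  -- the shell
  have hshell := volume_shell_le (r := r) (δ := 8 * s * R₀ ^ 2) (by positivity) (by linarith) a
  -- assemble
  calc vol3 ((R \ L) ∪ (L \ R))
      ≤ vol3 (N ∪ ((P₁ ∪ P₂ ∪ P₃ ∪ P₄ ∪ P₅ ∪ P₆ ∪ P₇ ∪ P₈) ∩ (R ∪ L)) ∪ SH) := measure_mono hsub
    _ ≤ vol3 N + vol3 ((P₁ ∪ P₂ ∪ P₃ ∪ P₄ ∪ P₅ ∪ P₆ ∪ P₇ ∪ P₈) ∩ (R ∪ L)) + vol3 SH :=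
        (measure_union_le _ _).trans (add_le_add (measure_union_le _ _) le_rfl)
    _ ≤ 0 + (vol3 ((P₁ ∪ P₂ ∪ P₃ ∪ P₄ ∪ P₅ ∪ P₆ ∪ P₇ ∪ P₈) ∩ R) + vol3 ((P₁ ∪ P₂ ∪ P₃ ∪ P₄ ∪ P₅ ∪ P₆ ∪ P₇ ∪ P₈) ∩ L)) + vol3 SH := by
        gcongr
        · exact le_of_eq volume_nullSet_eq_zero
        · rw [Set.inter_union_distrib_left]; exact measure_union_le _ _
    _ ≤ _ := by
        rw [zero_add]
        refine add_le_add ((add_le_add (pieces mR hRdom) (pieces mL hLdom)).trans (le_of_eq ?_)) hshell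
        ring

end Summit.QuantumFields.YangMills.Theorems.SwapVirialDeficit.ZeroModeSigma

end
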